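import Literature.AlgebraicGeometry.Deformation.SmoothLiftObstructionClassAtlasQuot
import HarnessLib

/-!
# The κ-class at the atlas does not depend on the gluings — QUOTIENT CURRENCY
# (Hartshorne, *Deformation Theory*, proof of Thm. 10.2 (a); [Oort1971] §2.2)

Layer `Literature/AlgebraicGeometry/Deformation`, namespace `Literature.AlgebraicGeometry.Deformation.LiftObstructionClassAtlasQuot` (continued).
PROOF FILE, THEOREMS ONLY (no definition, no instance, no notation, no named fact, no `sorry`).  Sequel head (vii-b) of the (U-glob) organ, scope
(2) (cell `hodgecm-mathlib`, P6 sub-desk P6b; count-neutral ★ capital).  SETTING as in `SmoothLiftObstructionClassAtlasQuot`.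

THE PRINT.  [Hartshorne2010, Thm. 10.2 (a), proof, p. 81]: «… so we get an obstruction `δ₃ ∈ H²(X₀, T⁰_{X₀} ⊗ J)`» — well defined.
[Oort1971, §2.2, pp. 277–280]: `D(X′; R → R′)` «does not depend on the choices made».

* §2.2 For two reduction-compatible gluing systems `ψ, ψ'` of the SAME charts: `ψ' ψ⁻¹` lies over the identity (`trans_symm_sub_mem`); on every
  face the restricted modification readings `α, β, γ'` satisfy `δ' = δ + α + β − γ'` (`faceReading_change`: ★ (c1)(c4) + ★
  `LiftCocycleExactnessQuot.reading_modified` on the vocabulary's `gluingOn`); hence `o' = o + d¹a` and **`[o'] = [o]` in `Ȟ²(i⁻¹𝒰; 𝒯_{X/κ})`**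
  (`cechMH2_mk_eq_of_gluings`, ★ `cochain_change_eq_add_cechMD1`) — the class depends on the charts and the cover only; it is the statement the
  (U-ab) vanishing input is typed against.

HC_CM is proved only modulo the printed citations until rung 0 closes; nothing here bears on a summit statement.

## References
* [Hartshorne2010] R. Hartshorne, *Deformation Theory*, GTM 257, Springer (2010): Thm. 10.2 (a) and its proof (p. 81).
* [Oort1971] F. Oort, *Finite group schemes, local moduli for abelian varieties, and lifting problems*, Compositio Math. 23 (1971), §2.2
  (pp. 277–280).
-/

noncomputable section

-- `TopCat.Presheaf`/`TopCat.Sheaf` are not reducible (as in Mathlib's `AlgebraicGeometry/Modules`).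
set_option backward.isDefEq.respectTransparency false

open CategoryTheory AlgebraicGeometry Opposite TopologicalSpace
open scoped TensorProduct

universe u

namespace Literature.AlgebraicGeometry.Deformation.LiftObstructionClassAtlasQuot

open Literature.AlgebraicGeometry.HodgeTheory Literature.AlgebraicGeometry.Modules
  Literature.AlgebraicGeometry.Motives Literature.AlgebraicGeometry.Morphisms
  Literature.AlgebraicGeometry.Deformation.LiftObstructionCechClassQuot
  Literature.AlgebraicGeometry.Deformation.AtlasQuot Literature.AlgebraicGeometry.Deformation.CanonicalLiftQuot
  Literature.AlgebraicGeometry.Deformation.ExtensionAutomorphisms Literature.AlgebraicGeometry.Deformation.ExtensionAutomorphismsQuot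
  Literature.AlgebraicGeometry.Deformation.LiftObstructionCocycleQuot Literature.AlgebraicGeometry.Deformation.LiftCocycleExactnessQuot

variable {A' : Type u} [CommRing A'] {κ : Type u} [Field κ] [Algebra A' κ] (hκ : Function.Surjective (algebraMap A' κ))
  {X : Over (Spec (CommRingCat.of κ))} [instΓ : ∀ W : X.left.Opens, Algebra A' Γ(X.left, W)]
  (halg : ∀ (W : X.left.Opens) (a : A'), algebraMap A' Γ(X.left, W) a = (constToPresheaf X).app (op W) (algebraMap A' κ a))
  (J : Ideal A') (φ : ↥J ≃ₗ[A'] κ)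

/-! ## §2 At the atlas: the κ-side closed-fibre layer over the indexed lifted atlas (★ `SmoothLiftAtlasVocabularyQuot`) -/

section Atlas

variable {X₀ : Scheme.{u}} [instΓ₀ : ∀ W : X₀.Opens, Algebra A' Γ(X₀, W)]
  (halg₀ : ∀ (W W' : X₀.Opens) (e : W' ≤ W) (a : A'), X₀.presheaf.map (homOfLE e).op (algebraMap A' Γ(X₀, W) a) = algebraMap A' Γ(X₀, W') a)
  (hJ : IsNilpotent J) {ι : Type u} (V : ι → X₀.affineOpens) (c : (a b : ι) → Γ(X₀, (V a).1))
  (hc : ∀ a b, (V a).1 ⊓ (V b).1 = X₀.basicOpen (c a b))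
  {P : ι → Type u} [∀ a, CommRing (P a)] [∀ a, Algebra A' (P a)] [∀ a, Module.Flat A' (P a)]
  (r : (a : ι) → P a →ₐ[A'] Γ(X₀, (V a).1)) (hr : ∀ a, Function.Surjective (r a))
  (hkr : ∀ a, RingHom.ker (r a) = J.map (algebraMap A' (P a)))
  -- the κ-side closed-fibre layer (R8): the honest closed fibre `X` over the residue field, lying over `X₀` by `i`
  (i : X.left ⟶ X₀) (hiV : ∀ a, IsAffineOpen (i ⁻¹ᵁ (V a).1))
  (𝔪 : Ideal A') (h𝔪J : 𝔪 * J = ⊥) (hJ𝔪 : J ≤ 𝔪)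
  (π : (W : X₀.Opens) → Γ(X₀, W) →ₐ[A'] Γ(X.left, i ⁻¹ᵁ W))
  (hπ : ∀ (a : ι) (W : X₀.Opens), W ≤ (V a).1 → (∃ q : Γ(X₀, (V a).1), W = X₀.basicOpen q) →
    Function.Surjective (π W) ∧ RingHom.ker (π W) = 𝔪.map (algebraMap A' Γ(X₀, W)))

/-! ### §2.2 The class does not depend on the gluings -/

omit [∀ a, Module.Flat A' (P a)] in
include hJ hr hkr in
/-- Two reduction-compatible gluings of the same charts differ by an automorphism over the identity modulo `J`:
`(ψ' ψ⁻¹) y − y ∈ J·L` (the reductions agree and `ker = J·L`, ★ (U-can) `ker_reduction`). [cite: Hartshorne2010, Thm. 10.2 (a) (proof), p. 81] -/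
theorem trans_symm_sub_mem (a b : ι) {W : X₀.Opens} (ha : W ≤ (V a).1) (hb : W ≤ (V b).1)
    (pa : ∃ q : Γ(X₀, (V a).1), W = X₀.basicOpen q)
    (e e' : chartLift V r a ha ≃ₐ[A'] chartLift V r b hb)
    (he : ∀ x, reduction (r b) (AtlasQuot.res hb) (halg₀ _ _ _) (e x) = reduction (r a) (AtlasQuot.res ha) (halg₀ _ _ _) x)
    (he' : ∀ x, reduction (r b) (AtlasQuot.res hb) (halg₀ _ _ _) (e' x) = reduction (r a) (AtlasQuot.res ha) (halg₀ _ _ _) x)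
    (y : chartLift V r a ha) : (e'.trans e.symm) y - y ∈ J • (⊤ : Submodule A' (chartLift V r a ha)) := by
  obtain ⟨q, hq⟩ := pa
  rw [mem_smul_top_iff, ← ker_reduction hJ (r a) (hr a) (hkr a) (AtlasQuot.res ha) (halg₀ _ _ _)
    ((V a).2.isLocalization_of_eq_basicOpen q (homOfLE ha) hq), RingHom.mem_ker, map_sub, sub_eq_zero, AlgEquiv.trans_apply]
  have h1 := he (e.symm (e' y))
  rw [AlgEquiv.apply_symm_apply, he'] at h1
  exact h1.symm

omit [Algebra A' κ] in
include hc in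
/-- **CHANGE OF GLUINGS ON ONE FACE.**  For two reduction-compatible gluing systems `ψ, ψ'` of the SAME charts with face readings `δ, δ'` on
`V_a ∩ V_b ∩ V_d` (★ vocabulary `readingAut … = disc …`), and the pair readings `γab, γbd, γad` of the modifications `ψ' ψ⁻¹` on the pair
overlaps: the RESTRICTED modification readings `α, β, γ'` (naturality squares along the closed-fibre restrictions `g`, ★ (c4) `reading_naturality`
with ★ vocabulary `gluingOn_restrict`∕`fibreRed_restrict`) satisfy `δ' = δ + α + β − γ'` (★ `LiftCocycleExactnessQuot.reading_modified` on the
restricted gluings `gluingOn`, whose modifications are `ψ'| ψ|⁻¹`). [cite: Hartshorne2010, Thm. 10.2 (a) (proof), p. 81] [cite: Oort1971, §2.2 (pp. 277–280)] -/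
theorem faceReading_change
    (ψ ψ' : (a b : ι) → chartLift V r a (inf_le_left : (V a).1 ⊓ (V b).1 ≤ (V a).1) ≃ₐ[A']
      chartLift V r b (inf_le_right : (V a).1 ⊓ (V b).1 ≤ (V b).1))
    (hψ : ∀ a b x, reduction (r b) (AtlasQuot.res (inf_le_right : (V a).1 ⊓ (V b).1 ≤ (V b).1)) (halg₀ _ _ _) (ψ a b x) =
      reduction (r a) (AtlasQuot.res (inf_le_left : (V a).1 ⊓ (V b).1 ≤ (V a).1)) (halg₀ _ _ _) x)
    (hψ' : ∀ a b x, reduction (r b) (AtlasQuot.res (inf_le_right : (V a).1 ⊓ (V b).1 ≤ (V b).1)) (halg₀ _ _ _) (ψ' a b x) =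
      reduction (r a) (AtlasQuot.res (inf_le_left : (V a).1 ⊓ (V b).1 ≤ (V a).1)) (halg₀ _ _ _) x)
    (g : ∀ ⦃W W' : X₀.Opens⦄, W' ≤ W → (Γ(X.left, i ⁻¹ᵁ W) →ₐ[A'] Γ(X.left, i ⁻¹ᵁ W')))
    (hg : ∀ ⦃W W' : X₀.Opens⦄ (h : W' ≤ W) (x : Γ(X₀, W)), g h (π W x) = π W' (AtlasQuot.res h x))
    (a b d : ι)
    {δ δ' : Derivation A' Γ(X.left, i ⁻¹ᵁ ((V a).1 ⊓ (V b).1 ⊓ (V d).1)) (Γ(X.left, i ⁻¹ᵁ ((V a).1 ⊓ (V b).1 ⊓ (V d).1)) ⊗[A'] ↥J)}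
    (hδ : readingAut halg₀ hJ V r hr hkr 𝔪 π hπ h𝔪J hJ𝔪 a (inf_le_left.trans inf_le_left : (V a).1 ⊓ (V b).1 ⊓ (V d).1 ≤ (V a).1) ⟨_, inf₃_eq_basicOpen₁ V c hc a b d⟩ δ = disc halg₀ hJ V c hc r hr hkr ψ hψ a b d)
    (hδ' : readingAut halg₀ hJ V r hr hkr 𝔪 π hπ h𝔪J hJ𝔪 a (inf_le_left.trans inf_le_left : (V a).1 ⊓ (V b).1 ⊓ (V d).1 ≤ (V a).1) ⟨_, inf₃_eq_basicOpen₁ V c hc a b d⟩ δ' = disc halg₀ hJ V c hc r hr hkr ψ' hψ' a b d)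
    {γab : Derivation A' Γ(X.left, i ⁻¹ᵁ ((V a).1 ⊓ (V b).1)) (Γ(X.left, i ⁻¹ᵁ ((V a).1 ⊓ (V b).1)) ⊗[A'] ↥J)}
    (hγab : readingAut halg₀ hJ V r hr hkr 𝔪 π hπ h𝔪J hJ𝔪 a (inf_le_left : (V a).1 ⊓ (V b).1 ≤ (V a).1) ⟨c a b, hc a b⟩ γab = (ψ' a b).trans (ψ a b).symm)
    {γbd : Derivation A' Γ(X.left, i ⁻¹ᵁ ((V b).1 ⊓ (V d).1)) (Γ(X.left, i ⁻¹ᵁ ((V b).1 ⊓ (V d).1)) ⊗[A'] ↥J)}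
    (hγbd : readingAut halg₀ hJ V r hr hkr 𝔪 π hπ h𝔪J hJ𝔪 b (inf_le_left : (V b).1 ⊓ (V d).1 ≤ (V b).1) ⟨c b d, hc b d⟩ γbd = (ψ' b d).trans (ψ b d).symm)
    {γad : Derivation A' Γ(X.left, i ⁻¹ᵁ ((V a).1 ⊓ (V d).1)) (Γ(X.left, i ⁻¹ᵁ ((V a).1 ⊓ (V d).1)) ⊗[A'] ↥J)}
    (hγad : readingAut halg₀ hJ V r hr hkr 𝔪 π hπ h𝔪J hJ𝔪 a (inf_le_left : (V a).1 ⊓ (V d).1 ≤ (V a).1) ⟨c a d, hc a d⟩ γad = (ψ' a d).trans (ψ a d).symm) :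
    ∃ α β γ' : Derivation A' Γ(X.left, i ⁻¹ᵁ ((V a).1 ⊓ (V b).1 ⊓ (V d).1)) (Γ(X.left, i ⁻¹ᵁ ((V a).1 ⊓ (V b).1 ⊓ (V d).1)) ⊗[A'] ↥J),
      (∀ x, α (g (inf_le_left : ((V a).1 ⊓ (V b).1 ⊓ (V d).1) ≤ (V a).1 ⊓ (V b).1) x) =
        LinearMap.rTensor ↥J (g (inf_le_left : ((V a).1 ⊓ (V b).1 ⊓ (V d).1) ≤ (V a).1 ⊓ (V b).1)).toLinearMap (γab x)) ∧
      (∀ x, β (g (le_inf (inf_le_left.trans inf_le_right) inf_le_right : ((V a).1 ⊓ (V b).1 ⊓ (V d).1) ≤ (V b).1 ⊓ (V d).1) x) =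
        LinearMap.rTensor ↥J (g (le_inf (inf_le_left.trans inf_le_right) inf_le_right : ((V a).1 ⊓ (V b).1 ⊓ (V d).1) ≤ (V b).1 ⊓ (V d).1)).toLinearMap (γbd x)) ∧
      (∀ x, γ' (g (le_inf (inf_le_left.trans inf_le_left) inf_le_right : ((V a).1 ⊓ (V b).1 ⊓ (V d).1) ≤ (V a).1 ⊓ (V d).1) x) =
        LinearMap.rTensor ↥J (g (le_inf (inf_le_left.trans inf_le_left) inf_le_right : ((V a).1 ⊓ (V b).1 ⊓ (V d).1) ≤ (V a).1 ⊓ (V d).1)).toLinearMap (γad x)) ∧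
      δ' = δ + α + β - γ' := by
  -- flatness of the chart lifts in play
  haveI := CanonicalLiftQuot.flat (r a) (AtlasQuot.res (inf_le_left.trans inf_le_left : (V a).1 ⊓ (V b).1 ⊓ (V d).1 ≤ (V a).1))
  haveI := CanonicalLiftQuot.flat (r b) (AtlasQuot.res (inf_le_left.trans inf_le_right : (V a).1 ⊓ (V b).1 ⊓ (V d).1 ≤ (V b).1))
  haveI := CanonicalLiftQuot.flat (r a) (AtlasQuot.res (inf_le_left : (V a).1 ⊓ (V b).1 ≤ (V a).1))
  haveI := CanonicalLiftQuot.flat (r b) (AtlasQuot.res (inf_le_left : (V b).1 ⊓ (V d).1 ≤ (V b).1))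
  haveI := CanonicalLiftQuot.flat (r a) (AtlasQuot.res (inf_le_left : (V a).1 ⊓ (V d).1 ≤ (V a).1))
  -- the three modifications of the restricted gluings on `W₃ = V a ⊓ V b ⊓ V d`, over the identity
  have hηab := trans_symm_sub_mem J halg₀ hJ V r hr hkr a b (inf_le_left.trans inf_le_left : (V a).1 ⊓ (V b).1 ⊓ (V d).1 ≤ (V a).1) (inf_le_left.trans inf_le_right : (V a).1 ⊓ (V b).1 ⊓ (V d).1 ≤ (V b).1) ⟨_, inf₃_eq_basicOpen₁ V c hc a b d⟩ (gluingOn halg₀ hJ V r hr hkr ψ hψ a b ((V a).1 ⊓ (V b).1 ⊓ (V d).1) (inf_le_left.trans inf_le_left : (V a).1 ⊓ (V b).1 ⊓ (V d).1 ≤ (V a).1) (inf_le_left.trans inf_le_right : (V a).1 ⊓ (V b).1 ⊓ (V d).1 ≤ (V b).1) ⟨_, inf₃_eq_basicOpen₁ V c hc a b d⟩ ⟨_, inf₃_eq_basicOpen₂ V c hc a b d⟩) (gluingOn halg₀ hJ V r hr hkr ψ' hψ' a b ((V a).1 ⊓ (V b).1 ⊓ (V d).1) (inf_le_left.trans inf_le_left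 : (V a).1 ⊓ (V b).1 ⊓ (V d).1 ≤ (V a).1) (inf_le_left.trans inf_le_right : (V a).1 ⊓ (V b).1 ⊓ (V d).1 ≤ (V b).1) ⟨_, inf₃_eq_basicOpen₁ V c hc a b d⟩ ⟨_, inf₃_eq_basicOpen₂ V c hc a b d⟩)
    (reduction_gluingOn halg₀ hJ V r hr hkr ψ hψ a b ((V a).1 ⊓ (V b).1 ⊓ (V d).1) (inf_le_left.trans inf_le_left : (V a).1 ⊓ (V b).1 ⊓ (V d).1 ≤ (V a).1) (inf_le_left.trans inf_le_right : (V a).1 ⊓ (V b).1 ⊓ (V d).1 ≤ (V b).1) ⟨_, inf₃_eq_basicOpen₁ V c hc a b d⟩ ⟨_, inf₃_eq_basicOpen₂ V c hc a b d⟩)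
    (reduction_gluingOn halg₀ hJ V r hr hkr ψ' hψ' a b ((V a).1 ⊓ (V b).1 ⊓ (V d).1) (inf_le_left.trans inf_le_left : (V a).1 ⊓ (V b).1 ⊓ (V d).1 ≤ (V a).1) (inf_le_left.trans inf_le_right : (V a).1 ⊓ (V b).1 ⊓ (V d).1 ≤ (V b).1) ⟨_, inf₃_eq_basicOpen₁ V c hc a b d⟩ ⟨_, inf₃_eq_basicOpen₂ V c hc a b d⟩)
  have hηbd := trans_symm_sub_mem J halg₀ hJ V r hr hkr b d (inf_le_left.trans inf_le_right : (V a).1 ⊓ (V b).1 ⊓ (V d).1 ≤ (V b).1) (inf_le_right : (V a).1 ⊓ (V b).1 ⊓ (V d).1 ≤ (V d).1) ⟨_, inf₃_eq_basicOpen₂ V c hc a b d⟩ (gluingOn halg₀ hJ V r hr hkr ψ hψ b d ((V a).1 ⊓ (V b).1 ⊓ (V d).1) (inf_le_left.trans inf_le_right : (V a).1 ⊓ (V b).1 ⊓ (V d).1 ≤ (V b).1) (inf_le_right : (V a).1 ⊓ (V b).1 ⊓ (V d).1 ≤ (V d).1) ⟨_, inf₃_eq_basicOpen₂ V c hc a b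 d⟩ ⟨_, inf₃_eq_basicOpen₃ V c hc a b d⟩) (gluingOn halg₀ hJ V r hr hkr ψ' hψ' b d ((V a).1 ⊓ (V b).1 ⊓ (V d).1) (inf_le_left.trans inf_le_right : (V a).1 ⊓ (V b).1 ⊓ (V d).1 ≤ (V b).1) (inf_le_right : (V a).1 ⊓ (V b).1 ⊓ (V d).1 ≤ (V d).1) ⟨_, inf₃_eq_basicOpen₂ V c hc a b d⟩ ⟨_, inf₃_eq_basicOpen₃ V c hc a b d⟩)
    (reduction_gluingOn halg₀ hJ V r hr hkr ψ hψ b d ((V a).1 ⊓ (V b).1 ⊓ (V d).1) (inf_le_left.trans inf_le_right : (V a).1 ⊓ (V b).1 ⊓ (V d).1 ≤ (V b).1) (inf_le_right : (V a).1 ⊓ (V b).1 ⊓ (V d).1 ≤ (V d).1) ⟨_, inf₃_eq_basicOpen₂ V c hc a b d⟩ ⟨_, inf₃_eq_basicOpen₃ V c hc a b d⟩)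
    (reduction_gluingOn halg₀ hJ V r hr hkr ψ' hψ' b d ((V a).1 ⊓ (V b).1 ⊓ (V d).1) (inf_le_left.trans inf_le_right : (V a).1 ⊓ (V b).1 ⊓ (V d).1 ≤ (V b).1) (inf_le_right : (V a).1 ⊓ (V b).1 ⊓ (V d).1 ≤ (V d).1) ⟨_, inf₃_eq_basicOpen₂ V c hc a b d⟩ ⟨_, inf₃_eq_basicOpen₃ V c hc a b d⟩)
  have hηad := trans_symm_sub_mem J halg₀ hJ V r hr hkr a d (inf_le_left.trans inf_le_left : (V a).1 ⊓ (V b).1 ⊓ (V d).1 ≤ (V a).1) (inf_le_right : (V a).1 ⊓ (V b).1 ⊓ (V d).1 ≤ (V d).1) ⟨_, inf₃_eq_basicOpen₁ V c hc a b d⟩ (gluingOn halg₀ hJ V r hr hkr ψ hψ a d ((V a).1 ⊓ (V b).1 ⊓ (V d).1) (inf_le_left.trans inf_le_left : (V a).1 ⊓ (V b).1 ⊓ (V d).1 ≤ (V a).1) (inf_le_right : (V a).1 ⊓ (V b).1 ⊓ (V d).1 ≤ (V d).1) ⟨_, inf₃_eq_basicOpen₁ V c hc a b d⟩ ⟨_,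 inf₃_eq_basicOpen₃ V c hc a b d⟩) (gluingOn halg₀ hJ V r hr hkr ψ' hψ' a d ((V a).1 ⊓ (V b).1 ⊓ (V d).1) (inf_le_left.trans inf_le_left : (V a).1 ⊓ (V b).1 ⊓ (V d).1 ≤ (V a).1) (inf_le_right : (V a).1 ⊓ (V b).1 ⊓ (V d).1 ≤ (V d).1) ⟨_, inf₃_eq_basicOpen₁ V c hc a b d⟩ ⟨_, inf₃_eq_basicOpen₃ V c hc a b d⟩)
    (reduction_gluingOn halg₀ hJ V r hr hkr ψ hψ a d ((V a).1 ⊓ (V b).1 ⊓ (V d).1) (inf_le_left.trans inf_le_left : (V a).1 ⊓ (V b).1 ⊓ (V d).1 ≤ (V a).1) (inf_le_right : (V a).1 ⊓ (V b).1 ⊓ (V d).1 ≤ (V d).1) ⟨_, inf₃_eq_basicOpen₁ V c hc a b d⟩ ⟨_, inf₃_eq_basicOpen₃ V c hc a b d⟩)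
    (reduction_gluingOn halg₀ hJ V r hr hkr ψ' hψ' a d ((V a).1 ⊓ (V b).1 ⊓ (V d).1) (inf_le_left.trans inf_le_left : (V a).1 ⊓ (V b).1 ⊓ (V d).1 ≤ (V a).1) (inf_le_right : (V a).1 ⊓ (V b).1 ⊓ (V d).1 ≤ (V d).1) ⟨_, inf₃_eq_basicOpen₁ V c hc a b d⟩ ⟨_, inf₃_eq_basicOpen₃ V c hc a b d⟩)
  -- their readings (★ (c1))
  obtain ⟨α, hα, -⟩ := existsUnique_reading 𝔪 J h𝔪J hJ𝔪 (fibreRed halg₀ V r π a (inf_le_left.trans inf_le_left : (V a).1 ⊓ (V b).1 ⊓ (V d).1 ≤ (V a).1))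
    (fibreRed_surjective halg₀ hJ V r hr hkr 𝔪 π hπ a (inf_le_left.trans inf_le_left : (V a).1 ⊓ (V b).1 ⊓ (V d).1 ≤ (V a).1) ⟨_, inf₃_eq_basicOpen₁ V c hc a b d⟩) (ker_fibreRed halg₀ hJ V r hr hkr 𝔪 π hπ hJ𝔪 a (inf_le_left.trans inf_le_left : (V a).1 ⊓ (V b).1 ⊓ (V d).1 ≤ (V a).1) ⟨_, inf₃_eq_basicOpen₁ V c hc a b d⟩)
    _ hηab
  obtain ⟨β, hβ, -⟩ := existsUnique_reading 𝔪 J h𝔪J hJ𝔪 (fibreRed halg₀ V r π b (inf_le_left.trans inf_le_right : (V a).1 ⊓ (V b).1 ⊓ (V d).1 ≤ (V b).1))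
    (fibreRed_surjective halg₀ hJ V r hr hkr 𝔪 π hπ b (inf_le_left.trans inf_le_right : (V a).1 ⊓ (V b).1 ⊓ (V d).1 ≤ (V b).1) ⟨_, inf₃_eq_basicOpen₂ V c hc a b d⟩) (ker_fibreRed halg₀ hJ V r hr hkr 𝔪 π hπ hJ𝔪 b (inf_le_left.trans inf_le_right : (V a).1 ⊓ (V b).1 ⊓ (V d).1 ≤ (V b).1) ⟨_, inf₃_eq_basicOpen₂ V c hc a b d⟩)
    _ hηbd
  obtain ⟨γ', hγ', -⟩ := existsUnique_reading 𝔪 J h𝔪J hJ𝔪 (fibreRed halg₀ V r π a (inf_le_left.trans inf_le_left : (V a).1 ⊓ (V b).1 ⊓ (V d).1 ≤ (V a).1))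
    (fibreRed_surjective halg₀ hJ V r hr hkr 𝔪 π hπ a (inf_le_left.trans inf_le_left : (V a).1 ⊓ (V b).1 ⊓ (V d).1 ≤ (V a).1) ⟨_, inf₃_eq_basicOpen₁ V c hc a b d⟩) (ker_fibreRed halg₀ hJ V r hr hkr 𝔪 π hπ hJ𝔪 a (inf_le_left.trans inf_le_left : (V a).1 ⊓ (V b).1 ⊓ (V d).1 ≤ (V a).1) ⟨_, inf₃_eq_basicOpen₁ V c hc a b d⟩)
    _ hηad
  -- the squares (★ (c4) along the canonical restrictions of the chart lifts)
  have sq : ∀ (x y : ι) (hxy : ((V a).1 ⊓ (V b).1 ⊓ (V d).1) ≤ (V x).1 ⊓ (V y).1) (hx : ((V a).1 ⊓ (V b).1 ⊓ (V d).1) ≤ (V x).1) (hy : ((V a).1 ⊓ (V b).1 ⊓ (V d).1) ≤ (V y).1)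
      (px : ∃ q : Γ(X₀, (V x).1), ((V a).1 ⊓ (V b).1 ⊓ (V d).1) = X₀.basicOpen q) (py : ∃ q : Γ(X₀, (V y).1), ((V a).1 ⊓ (V b).1 ⊓ (V d).1) = X₀.basicOpen q)
      [Module.Flat A' (chartLift V r x (inf_le_left : (V x).1 ⊓ (V y).1 ≤ (V x).1))] [Module.Flat A' (chartLift V r x hx)]
      {γxy : Derivation A' Γ(X.left, i ⁻¹ᵁ ((V x).1 ⊓ (V y).1)) (Γ(X.left, i ⁻¹ᵁ ((V x).1 ⊓ (V y).1)) ⊗[A'] ↥J)}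
      (_ : readingAut halg₀ hJ V r hr hkr 𝔪 π hπ h𝔪J hJ𝔪 x (inf_le_left : (V x).1 ⊓ (V y).1 ≤ (V x).1) ⟨c x y, hc x y⟩ γxy = (ψ' x y).trans (ψ x y).symm)
      {ε : Derivation A' Γ(X.left, i ⁻¹ᵁ ((V a).1 ⊓ (V b).1 ⊓ (V d).1)) (Γ(X.left, i ⁻¹ᵁ ((V a).1 ⊓ (V b).1 ⊓ (V d).1)) ⊗[A'] ↥J)}
      (_ : autOfClosedFibreDerivation 𝔪 J h𝔪J hJ𝔪 (fibreRed halg₀ V r π x hx)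
        (fibreRed_surjective halg₀ hJ V r hr hkr 𝔪 π hπ x hx px) (ker_fibreRed halg₀ hJ V r hr hkr 𝔪 π hπ hJ𝔪 x hx px) ε =
        (gluingOn halg₀ hJ V r hr hkr ψ' hψ' x y ((V a).1 ⊓ (V b).1 ⊓ (V d).1) hx hy px py).trans (gluingOn halg₀ hJ V r hr hkr ψ hψ x y ((V a).1 ⊓ (V b).1 ⊓ (V d).1) hx hy px py).symm),
      ∀ z, ε (g hxy z) = LinearMap.rTensor ↥J (g hxy).toLinearMap (γxy z) := by
    intro x y hxy hx hy px py _ _ γxy hγxy ε hε z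
    refine reading_naturality 𝔪 J h𝔪J hJ𝔪 (fibreRed halg₀ V r π x (inf_le_left : (V x).1 ⊓ (V y).1 ≤ (V x).1))
      (fibreRed_surjective halg₀ hJ V r hr hkr 𝔪 π hπ x _ ⟨c x y, hc x y⟩) (ker_fibreRed halg₀ hJ V r hr hkr 𝔪 π hπ hJ𝔪 x _ ⟨c x y, hc x y⟩)
      (fibreRed halg₀ V r π x hx) (fibreRed_surjective halg₀ hJ V r hr hkr 𝔪 π hπ x hx px) (ker_fibreRed halg₀ hJ V r hr hkr 𝔪 π hπ hJ𝔪 x hx px)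
      (restrict (r x) (AtlasQuot.res (inf_le_left : (V x).1 ⊓ (V y).1 ≤ (V x).1)) (AtlasQuot.res hx)
        (liftSubmonoid_mono _ _ _ (AtlasQuot.res hxy) fun q => AtlasQuot.res_res inf_le_left hxy q))
      (g hxy) (fun w => fibreRed_restrict halg₀ V r π g hg x (inf_le_left : (V x).1 ⊓ (V y).1 ≤ (V x).1) hxy w) hγxy hε (fun w => ?_) z
    -- `restrict ((ψ' ψ⁻¹) w) = (ψ'| ψ|⁻¹) (restrict w)` (★ vocabulary `gluingOn_restrict`)
    apply (gluingOn halg₀ hJ V r hr hkr ψ hψ x y ((V a).1 ⊓ (V b).1 ⊓ (V d).1) hx hy px py).injective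
    rw [AlgEquiv.trans_apply, AlgEquiv.trans_apply, AlgEquiv.apply_symm_apply]
    erw [gluingOn_restrict halg₀ hJ V r hr hkr ψ hψ x y ((V a).1 ⊓ (V b).1 ⊓ (V d).1) hx hy px py,
      gluingOn_restrict halg₀ hJ V r hr hkr ψ' hψ' x y ((V a).1 ⊓ (V b).1 ⊓ (V d).1) hx hy px py, AlgEquiv.apply_symm_apply]
  refine ⟨α, β, γ', fun z => sq a b _ _ _ ⟨_, inf₃_eq_basicOpen₁ V c hc a b d⟩ ⟨_, inf₃_eq_basicOpen₂ V c hc a b d⟩ hγab hα z, fun z => sq b d _ _ _ ⟨_, inf₃_eq_basicOpen₂ V c hc a b d⟩ ⟨_, inf₃_eq_basicOpen₃ V c hc a b d⟩ hγbd hβ z,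
    fun z => sq a d _ _ _ ⟨_, inf₃_eq_basicOpen₁ V c hc a b d⟩ ⟨_, inf₃_eq_basicOpen₃ V c hc a b d⟩ hγad hγ' z, ?_⟩
  -- the reading of the modified discrepancy (★ `reading_modified`) is that of `disc ψ'`
  have hδ₀ := hδ
  rw [AtlasQuot.disc] at hδ₀
  have hmod := reading_modified 𝔪 J h𝔪J hJ𝔪 (fibreRed halg₀ V r π a (inf_le_left.trans inf_le_left : (V a).1 ⊓ (V b).1 ⊓ (V d).1 ≤ (V a).1))
    (fibreRed_surjective halg₀ hJ V r hr hkr 𝔪 π hπ a (inf_le_left.trans inf_le_left : (V a).1 ⊓ (V b).1 ⊓ (V d).1 ≤ (V a).1) ⟨_, inf₃_eq_basicOpen₁ V c hc a b d⟩) (ker_fibreRed halg₀ hJ V r hr hkr 𝔪 π hπ hJ𝔪 a (inf_le_left.trans inf_le_left : (V a).1 ⊓ (V b).1 ⊓ (V d).1 ≤ (V a).1) ⟨_, inf₃_eq_basicOpen₁ V c hc a b d⟩)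
    (fibreRed halg₀ V r π b (inf_le_left.trans inf_le_right : (V a).1 ⊓ (V b).1 ⊓ (V d).1 ≤ (V b).1))
    (fibreRed_surjective halg₀ hJ V r hr hkr 𝔪 π hπ b (inf_le_left.trans inf_le_right : (V a).1 ⊓ (V b).1 ⊓ (V d).1 ≤ (V b).1) ⟨_, inf₃_eq_basicOpen₂ V c hc a b d⟩) (ker_fibreRed halg₀ hJ V r hr hkr 𝔪 π hπ hJ𝔪 b (inf_le_left.trans inf_le_right : (V a).1 ⊓ (V b).1 ⊓ (V d).1 ≤ (V b).1) ⟨_, inf₃_eq_basicOpen₂ V c hc a b d⟩)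
    (fibreRed_gluingOn halg₀ hJ V r hr hkr ψ hψ π a b ((V a).1 ⊓ (V b).1 ⊓ (V d).1) (inf_le_left.trans inf_le_left : (V a).1 ⊓ (V b).1 ⊓ (V d).1 ≤ (V a).1) (inf_le_left.trans inf_le_right : (V a).1 ⊓ (V b).1 ⊓ (V d).1 ≤ (V b).1) ⟨_, inf₃_eq_basicOpen₁ V c hc a b d⟩ ⟨_, inf₃_eq_basicOpen₂ V c hc a b d⟩) hδ₀ hα hβ hγ'
  have e3 : ∀ {T₁ T₂ : Type u} [CommRing T₁] [CommRing T₂] [Algebra A' T₁] [Algebra A' T₂] (G G' : T₁ ≃ₐ[A'] T₂),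
      (G'.trans G.symm).trans G = G' := fun G G' =>
    AlgEquiv.ext fun w => by rw [AlgEquiv.trans_apply, AlgEquiv.trans_apply, AlgEquiv.apply_symm_apply]
  have hδ₀' := hδ'
  rw [AtlasQuot.disc] at hδ₀'
  rw [e3, e3, e3, ← hδ₀'] at hmod
  exact (autOfClosedFibreDerivation_injective 𝔪 J h𝔪J hJ𝔪 _ _ _ hmod).symm

include hκ halg hc hiV in
/-- **THE κ-CLASS DOES NOT DEPEND ON THE GLUINGS** («so we get an obstruction `δ₃ ∈ H²(X₀, T⁰_{X₀} ⊗ J)`», well defined).  Two reduction-compatible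
gluing systems `ψ, ψ'` of the SAME charts of the lifted atlas (★ vocabulary), their face readings `δ, δ'` (`readingAut … = disc …`) represented by
cocycles `o, o' ∈ Ž²(i⁻¹𝒰; 𝒯_{X/κ})`: then `[o'] = [o]` in `Ȟ²` — the pair readings of the modifications `ψ' ψ⁻¹` form a 1-cochain `a` (★
`existsUnique_cochain₁_rep`) with `o' = o + d¹a` (`faceReading_change` on every face + ★ `cochain_change_eq_add_cechMD1`).  The class thus depends
on the charts and the cover only; it is the statement the (U-ab) vanishing input is typed against.
[cite: Hartshorne2010, Thm. 10.2 (a) (proof), p. 81] [cite: Oort1971, §2.2 (pp. 277–280)] -/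
theorem cechMH2_mk_eq_of_gluings
    (hπnat : ∀ ⦃W W' : X₀.Opens⦄ (h : W' ≤ W) (x : Γ(X₀, W)),
      X.left.presheaf.map (homOfLE (i.preimage_mono h)).op (π W x) = π W' (AtlasQuot.res h x))
    (ψ ψ' : (a b : ι) → chartLift V r a (inf_le_left : (V a).1 ⊓ (V b).1 ≤ (V a).1) ≃ₐ[A']
      chartLift V r b (inf_le_right : (V a).1 ⊓ (V b).1 ≤ (V b).1))
    (hψ : ∀ a b x, reduction (r b) (AtlasQuot.res (inf_le_right : (V a).1 ⊓ (V b).1 ≤ (V b).1)) (halg₀ _ _ _) (ψ a b x) =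
      reduction (r a) (AtlasQuot.res (inf_le_left : (V a).1 ⊓ (V b).1 ≤ (V a).1)) (halg₀ _ _ _) x)
    (hψ' : ∀ a b x, reduction (r b) (AtlasQuot.res (inf_le_right : (V a).1 ⊓ (V b).1 ≤ (V b).1)) (halg₀ _ _ _) (ψ' a b x) =
      reduction (r a) (AtlasQuot.res (inf_le_left : (V a).1 ⊓ (V b).1 ≤ (V a).1)) (halg₀ _ _ _) x)
    (δ δ' : (a b d : ι) → Derivation A' Γ(X.left, i ⁻¹ᵁ ((V a).1 ⊓ (V b).1 ⊓ (V d).1)) (Γ(X.left, i ⁻¹ᵁ ((V a).1 ⊓ (V b).1 ⊓ (V d).1)) ⊗[A'] ↥J))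
    (hδ : ∀ a b d, readingAut halg₀ hJ V r hr hkr 𝔪 π hπ h𝔪J hJ𝔪 a (inf_le_left.trans inf_le_left : (V a).1 ⊓ (V b).1 ⊓ (V d).1 ≤ (V a).1) ⟨_, inf₃_eq_basicOpen₁ V c hc a b d⟩ (δ a b d) = disc halg₀ hJ V c hc r hr hkr ψ hψ a b d)
    (hδ' : ∀ a b d, readingAut halg₀ hJ V r hr hkr 𝔪 π hπ h𝔪J hJ𝔪 a (inf_le_left.trans inf_le_left : (V a).1 ⊓ (V b).1 ⊓ (V d).1 ≤ (V a).1) ⟨_, inf₃_eq_basicOpen₁ V c hc a b d⟩ (δ' a b d) = disc halg₀ hJ V c hc r hr hkr ψ' hψ' a b d)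
    {o o' : CechMC2 X.hom (tangentSheaf X) (fun a => i ⁻¹ᵁ (V a).1)}
    (ho : ∀ (a b d : ι) (x : Γ(X.left, i ⁻¹ᵁ (V a).1 ⊓ i ⁻¹ᵁ (V b).1 ⊓ i ⁻¹ᵁ (V d).1)),
      δ a b d x = (show Γ(X.left, i ⁻¹ᵁ (V a).1 ⊓ i ⁻¹ᵁ (V b).1 ⊓ i ⁻¹ᵁ (V d).1) from
        appLE (o a b d) (𝟙 _) (dSection X _ x)) ⊗ₜ φ.symm 1)
    (ho' : ∀ (a b d : ι) (x : Γ(X.left, i ⁻¹ᵁ (V a).1 ⊓ i ⁻¹ᵁ (V b).1 ⊓ i ⁻¹ᵁ (V d).1)),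
      δ' a b d x = (show Γ(X.left, i ⁻¹ᵁ (V a).1 ⊓ i ⁻¹ᵁ (V b).1 ⊓ i ⁻¹ᵁ (V d).1) from
        appLE (o' a b d) (𝟙 _) (dSection X _ x)) ⊗ₜ φ.symm 1)
    (ho₂ : o ∈ cechMZ2 X.hom (tangentSheaf X) (fun a => i ⁻¹ᵁ (V a).1))
    (ho₂' : o' ∈ cechMZ2 X.hom (tangentSheaf X) (fun a => i ⁻¹ᵁ (V a).1)) :
    CechMH2.mk X.hom (tangentSheaf X) (fun a => i ⁻¹ᵁ (V a).1) ⟨o', ho₂'⟩ =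
      CechMH2.mk X.hom (tangentSheaf X) (fun a => i ⁻¹ᵁ (V a).1) ⟨o, ho₂⟩ := by
  have hb' := preimage_inf_eq_basicOpen (X := X) V c hc i hiV
  -- the κ-side restriction maps as `A'`-algebra maps (★ `exists_algHom_res`), compatible with `π` by `hπnat`
  have hex := fun (W W' : X₀.Opens) (h : W' ≤ W) =>
    LiftObstructionCechClassQuot.exists_algHom_res (X := X) halg (i.preimage_mono h)
  choose g hg' using hex
  have hg : ∀ ⦃W W' : X₀.Opens⦄ (h : W' ≤ W) (x : Γ(X₀, W)), g W W' h (π W x) = π W' (AtlasQuot.res h x) :=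
    fun W W' h x => by rw [hg', hπnat]
  -- the pair readings of the modifications `ψ' ψ⁻¹` (★ (c1)) and their 1-cochain
  have hγ : ∀ a b, ∃ γ : Derivation A' Γ(X.left, i ⁻¹ᵁ ((V a).1 ⊓ (V b).1)) (Γ(X.left, i ⁻¹ᵁ ((V a).1 ⊓ (V b).1)) ⊗[A'] ↥J),
      readingAut halg₀ hJ V r hr hkr 𝔪 π hπ h𝔪J hJ𝔪 a (inf_le_left : (V a).1 ⊓ (V b).1 ≤ (V a).1) ⟨c a b, hc a b⟩ γ =
        (ψ' a b).trans (ψ a b).symm := fun a b => by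
    haveI := CanonicalLiftQuot.flat (r a) (AtlasQuot.res (inf_le_left : (V a).1 ⊓ (V b).1 ≤ (V a).1))
    exact (existsUnique_reading 𝔪 J h𝔪J hJ𝔪 _ _ _ _ (trans_symm_sub_mem J halg₀ hJ V r hr hkr a b inf_le_left inf_le_right
      ⟨c a b, hc a b⟩ (ψ a b) (ψ' a b) (hψ a b) (hψ' a b))).exists
  choose γ hγ using hγ
  obtain ⟨acoch, hac, -⟩ := existsUnique_cochain₁_rep hκ halg J φ (fun a => (⟨i ⁻¹ᵁ (V a).1, hiV a⟩ : X.left.affineOpens))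
    (fun a b => i.app (V a).1 (c a b)) hb' γ
  -- every face: `δ' = δ + α + β − γ'` with the restricted modification readings
  have H := fun a b d => faceReading_change J halg₀ hJ V c hc r hr hkr i 𝔪 h𝔪J hJ𝔪 π hπ ψ ψ' hψ hψ' g hg a b d
    (hδ a b d) (hδ' a b d) (hγ a b) (hγ b d) (hγ a d)
  choose α β γ' hα hβ hγ' hch using H
  -- hence `o' = o + d¹a`, and the classes agree (★ `SmoothLiftObstructionCechClassQuot` §6)
  have e := LiftObstructionCechClassQuot.cochain_change_eq_add_cechMD1 hκ halg J φ
    (fun a => (⟨i ⁻¹ᵁ (V a).1, hiV a⟩ : X.left.affineOpens)) (fun a b => i.app (V a).1 (c a b)) hb'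
    (δ := δ) (δ' := δ') (γ := γ) (o := o) (o' := o') (a := acoch) ho ho' hac
    (fun a b d => g _ _ (inf_le_left : ((V a).1 ⊓ (V b).1 ⊓ (V d).1) ≤ (V a).1 ⊓ (V b).1))
    (fun a b d x => hg' ((V a).1 ⊓ (V b).1) ((V a).1 ⊓ (V b).1 ⊓ (V d).1) inf_le_left x)
    (fun a b d => g _ _ (le_inf (inf_le_left.trans inf_le_right) inf_le_right : ((V a).1 ⊓ (V b).1 ⊓ (V d).1) ≤ (V b).1 ⊓ (V d).1))
    (fun a b d x => hg' ((V b).1 ⊓ (V d).1) ((V a).1 ⊓ (V b).1 ⊓ (V d).1) (le_inf (inf_le_left.trans inf_le_right) inf_le_right) x)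
    (fun a b d => g _ _ (le_inf (inf_le_left.trans inf_le_left) inf_le_right : ((V a).1 ⊓ (V b).1 ⊓ (V d).1) ≤ (V a).1 ⊓ (V d).1))
    (fun a b d x => hg' ((V a).1 ⊓ (V d).1) ((V a).1 ⊓ (V b).1 ⊓ (V d).1) (le_inf (inf_le_left.trans inf_le_left) inf_le_right) x)
    α β γ' hα hβ hγ' hch
  exact LiftObstructionCechClassQuot.cechMH2_mk_eq_of_eq_add_cechMD1
    (fun a => (⟨i ⁻¹ᵁ (V a).1, hiV a⟩ : X.left.affineOpens)) e ho₂ ho₂'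

end Atlas

end Literature.AlgebraicGeometry.Deformation.LiftObstructionClassAtlasQuot

end
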